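import Summits.KontsevichZagierPeriods.Zeta5Search.RVLargeParamVCover
import HarnessLib

/-!
# RVLargeParamZCoverBands — the cover by bands of the target exponent (fam-rv gen 9, file 7; request #9.4)

HONEST FRAMING: systematic search; no irrationality claim unless certified.  This file starts the PROOF of the combinatorial cover
`LargeParamZCover` (gen 9 file 6, `RVLargeParamVCover.lean`) by splitting it along the target exponent
`t = −N_p(b) + lpBonus(b,p)` of the large-parameter constant-term floor (V⁺):

* PROVED — the TRIVIAL BAND `t ≤ −6`: with at most one long block no residue class holds two poles
  (`classPoleCount_le_one_of_short_blocks`), a single pole has order at most six (`blockCount_le`), so every pole class has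
  `ν_x ≥ E_x ≥ −6 ≥ t` and the COUNTING test fires for `b` and for `b + e_j` (`classNu_ge_neg_six`, `countingCase_of_le_neg_six`,
  `zCoverPair_of_le_neg_six`).
* OBSERVED (minted by this cell from an exact census, NOT published results; `@[conjecture]`, used only as explicit hypotheses):
  `LargeParamZCoverMid` — the cover on the MID BAND `−5 ≤ t ≤ −4`; `LargeParamHighBandCounting` — on the HIGH BAND `t ≥ −3` the
  counting test fires for both constant terms.  Exact census (`pub-zeta5-fam-rv/gen9/`, outputs `out/`): (i) `rv9_zlayer.py` — all
  4,064,552 pairs `(c,p)`, `c ∈ {b, b+e_j}`, `b₀ ≤ 33`, window primes `5 ≤ p ≤ m₁(b)`: the four tests cover every pair (residual 0);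
  (ii) `rv9_diag3.py` — for a FIXED prime the WHOLE window `b₀ ≤ p² − 3` over every parameter vector with at most one long block
  (no `m₁` restriction): `p = 5`: 4,695 pairs, `p = 7`: 64,071, `p = 11`: 2,236,367 — every pair covered, and every pair failing the
  counting test (248 / 2,725 / 72,310 of them) has `t ∈ {−5, −4}`, `N_p(b) ∈ {5, 6, 7}`, deficient poles of order 5 or 6 at level 1
  or 2 only, and `b₀ ≤ 4.4·p`; (iii) `rv9_diag2.py`/`rv9_diag4.py` — the same band statement over all window primes for `b₀ ≤ 27`;
  (iv) `rv9_tmax.py` — `t ≤ 0` on all 2.3·10⁶ regime instances with `b₀ ≤ 24` (all primes `p < m₁(b) + 40`).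
* PROVED — `LargeParamZCoverMid → LargeParamHighBandCounting → LargeParamZCover` (`largeParamZCover_of_bands`), hence the chain to
  `LargeParamVFloor`, `LargeParamClassLaw` and `FlatGaugeLawF1` (gen 8/9 nodes).

`p`-adic valuations of rational numbers and block combinatorics only; nothing about irrationality.
-/

noncomputable section

open Finset

namespace Summit.KontsevichZagierPeriods.Zeta5Search.ClusterValuation

section BandLemmas

variable {p : ℕ}

/-- Every net exponent is at least `−6`: at most seven blocks pass through a position. -/
theorem netExp_ge_neg_six (c : ℕ → ℤ) (s : ℕ) : -6 ≤ netExp c s := by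
  have h := blockCount_le c s
  unfold netExp
  split_ifs <;> omega

/-- A residue class holding at most one pole has `E_x ≥ −6`. -/
theorem classExp_ge_neg_six (c : ℕ → ℤ) (x : ℕ) (h1 : classPoleCount c p x ≤ 1) : -6 ≤ classExp c p x := by
  have hle : ∑ s ∈ classSet c p x, (if netExp c s < 0 then (-6 : ℤ) else 0) ≤ ∑ s ∈ classSet c p x, netExp c s :=
    Finset.sum_le_sum fun s _ => by
      have := netExp_ge_neg_six c s
      split_ifs with h <;> omega
  have heq : ∑ s ∈ classSet c p x, (if netExp c s < 0 then (-6 : ℤ) else 0)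
      = (((classSet c p x).filter fun s => netExp c s < 0).card : ℤ) * (-6) := by
    rw [← Finset.sum_filter, Finset.sum_const, nsmul_eq_mul]
  have hcard : (((classSet c p x).filter fun s => netExp c s < 0).card : ℤ) ≤ 1 := by
    unfold classPoleCount at h1
    exact_mod_cast h1
  have h0 : (0 : ℤ) ≤ (((classSet c p x).filter fun s => netExp c s < 0).card : ℤ) := Nat.cast_nonneg _
  have hsum : -6 ≤ ∑ s ∈ classSet c p x, netExp c s := by linarith
  unfold classExp
  split_ifs <;> linarith

/-- Hence `ν_x ≥ −6` for a class holding at most one pole. -/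
theorem classNu_ge_neg_six (c : ℕ → ℤ) (x : ℕ) (h1 : classPoleCount c p x ≤ 1) : -6 ≤ classNu c p x := by
  have h := classExp_ge_neg_six c x h1
  unfold classNu
  split_ifs
  · exact h.trans (le_max_left _ _)
  · exact h

end BandLemmas

end Summit.KontsevichZagierPeriods.Zeta5Search.ClusterValuation

namespace Summit.KontsevichZagierPeriods.Zeta5Search.RVFlatGauge

open Summit.KontsevichZagierPeriods.Zeta5Search.CasoratianValuation (shift InPolytope pairFloors)
open Summit.KontsevichZagierPeriods.Zeta5Search.ClusterValuation (classPoleCount classNu_ge_neg_six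
  classPoleCount_le_one_of_short_blocks classPoleCount_shift_le)
open Cap

variable {p : ℕ}

/-- **TRIVIAL BAND (PROVED):** if no class holds two poles and `t ≤ −6`, the counting test fires. -/
theorem countingCase_of_le_neg_six (c : ℕ → ℤ) (h1 : ∀ x, classPoleCount c p x ≤ 1) {t : ℤ} (ht : t ≤ -6) :
    countingCase c p t = true := by
  unfold countingCase
  exact decide_eq_true fun x _ _ => ht.trans (classNu_ge_neg_six c x (h1 x))

/-- **TRIVIAL BAND OF THE COVER (PROVED):** with at most one long block and `−N_p(b) + lpBonus(b,p) ≤ −6`, both `b` and `b + e_j`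
pass the counting test, hence `provedCaseZ`. -/
theorem zCoverPair_of_le_neg_six (b : ℕ → ℤ) {j i : ℕ} (hb : InPolytope b) (hj1 : 1 ≤ j) (hpr : p.Prime)
    (hshort : ∀ k ∈ (range 7).erase i, b 0 - 2 * b (k + 1) < p) (ht : -pairFloors b p + lpBonus b p ≤ -6) :
    provedCaseZ b p (-pairFloors b p + lpBonus b p) = true ∧
      provedCaseZ (shift b j) p (-pairFloors b p + lpBonus b p) = true := by
  haveI : Fact p.Prime := ⟨hpr⟩
  have h1 : ∀ x, classPoleCount b p x ≤ 1 := fun x => classPoleCount_le_one_of_short_blocks b hb hpr.pos hshort x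
  have h1' : ∀ x, classPoleCount (shift b j) p x ≤ 1 := fun x => (classPoleCount_shift_le b hb.1 hj1 p x).trans (h1 x)
  simp only [provedCaseZ, Bool.or_eq_true]
  exact ⟨Or.inl (Or.inl (Or.inl (countingCase_of_le_neg_six b h1 ht))),
    Or.inl (Or.inl (Or.inl (countingCase_of_le_neg_six (shift b j) h1' ht)))⟩

/-- **MID BAND OF THE COVER, OBSERVED** (minted by this cell; NOT a published result): the combinatorial cover on the pairs with
`−5 ≤ −N_p(b) + lpBonus(b,p) ≤ −4` — by the exact census the only band in which the counting test ever fails. -/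
@[conjecture] def LargeParamZCoverMid : Prop :=
  ∀ (b : ℕ → ℤ) (j p i : ℕ), InPolytope b → 1 ≤ j → j ≤ 7 → InPolytope (shift b j) → p.Prime → 5 ≤ p →
    (b 0 + 2 : ℤ) < (p : ℤ) ^ 2 → (∀ k ∈ (range 7).erase i, b 0 - 2 * b (k + 1) < p) →
    -5 ≤ -pairFloors b p + lpBonus b p → -pairFloors b p + lpBonus b p ≤ -4 →
    provedCaseZ b p (-pairFloors b p + lpBonus b p) = true ∧
      provedCaseZ (shift b j) p (-pairFloors b p + lpBonus b p) = true

/-- **HIGH BAND IS COUNTING, OBSERVED** (minted by this cell; NOT a published result): for `−N_p(b) + lpBonus(b,p) ≥ −3` both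
constant terms pass the counting test (exact census: no pair failing the counting test has `t ≥ −3`). -/
@[conjecture] def LargeParamHighBandCounting : Prop :=
  ∀ (b : ℕ → ℤ) (j p i : ℕ), InPolytope b → 1 ≤ j → j ≤ 7 → InPolytope (shift b j) → p.Prime → 5 ≤ p →
    (b 0 + 2 : ℤ) < (p : ℤ) ^ 2 → (∀ k ∈ (range 7).erase i, b 0 - 2 * b (k + 1) < p) →
    -3 ≤ -pairFloors b p + lpBonus b p →
    countingCase b p (-pairFloors b p + lpBonus b p) = true ∧
      countingCase (shift b j) p (-pairFloors b p + lpBonus b p) = true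

/-- **REDUCTION (PROVED): the two bands give the cover** (the band `t ≤ −6` is the proved trivial band). -/
theorem largeParamZCover_of_bands (hM : LargeParamZCoverMid) (hH : LargeParamHighBandCounting) : LargeParamZCover := by
  intro b j p i hb hj1 hj7 hb' hpr hp5 hwin hshort
  rcases le_or_gt (-pairFloors b p + lpBonus b p) (-6) with h6 | h6
  · exact zCoverPair_of_le_neg_six b hb hj1 hpr hshort h6
  rcases le_or_gt (-pairFloors b p + lpBonus b p) (-4) with h4 | h4
  · exact hM b j p i hb hj1 hj7 hb' hpr hp5 hwin hshort (by omega) h4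
  · obtain ⟨h1, h2⟩ := hH b j p i hb hj1 hj7 hb' hpr hp5 hwin hshort (by omega)
    simp only [provedCaseZ, Bool.or_eq_true]
    exact ⟨Or.inl (Or.inl (Or.inl h1)), Or.inl (Or.inl (Or.inl h2))⟩

/-- bands ⇒ (V⁺). -/
theorem largeParamVFloor_of_bands (hM : LargeParamZCoverMid) (hH : LargeParamHighBandCounting) : LargeParamVFloor :=
  largeParamVFloor_of_zCover (largeParamZCover_of_bands hM hH)

/-- bands ⇒ (CV⁺). -/
theorem largeParamClassLaw_of_bands (hM : LargeParamZCoverMid) (hH : LargeParamHighBandCounting) : LargeParamClassLaw :=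
  largeParamClassLaw_of_zCover (largeParamZCover_of_bands hM hH)

/-- bands ⇒ FLAT on (F1). -/
theorem flatGaugeLawF1_of_bands (hM : LargeParamZCoverMid) (hH : LargeParamHighBandCounting) : FlatGaugeLawF1 :=
  flatGaugeLawF1_of_zCover (largeParamZCover_of_bands hM hH)

/- Sanity (kernel `decide`): on `b = (15; 7,7,7,7,5,5,0)`, `p = 7` (`N = 6`, `lpBonus = 1`, `t = −5`: mid band) the counting
test fails (the palindromic test at level `−6` fires, `RVLargeParamVCases`); on `b = (20; 9,9,9,9,9,9,0)`, `p = 5` (`N = 12`,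
`lpBonus = 1`, `t = −11`: trivial band) the counting test fires. -/
example : countingCase (fun k => [(15 : ℤ), 7, 7, 7, 7, 5, 5, 0].getD k 0) 7 (-5) = false := by decide
example : countingCase (fun k => [(20 : ℤ), 9, 9, 9, 9, 9, 9, 0].getD k 0) 5 (-11) = true := by decide

end Summit.KontsevichZagierPeriods.Zeta5Search.RVFlatGauge

end
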